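import Summits.AtomisticToContinuum.Crystallization.Theorems.ChargedEnergyGapAffineChart
import HarnessLib

/-!
# «AffineStabilityFcc» — [A-i] AT THE fcc REFERENCE, IN THE KERNEL (lens-3 g67; handoff g66 → g67 target 1, critic row 1271)

The reference-class input of NODE 65 («AffineChart», `…Theorems.ChargedEnergyGapAffineChart` §C),
`SitewiseAffineStabilityB s lam ℓ μ₀ κ` — at every motif site of an admissible reference and for every linear `A`, the unexcised quadratic
site form of the affine field dominates `κ·⟪u, A u⟫²` for all unit `u` — is PROVED here for the stress-free fcc reference `fccRef a₀` with
`κ = 3/8` (hence `κ = 1/5`, the record value; part 29b needs `κ ≥ 1/10`), from pieces already in the tree: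

* `Fcc.quadSite_eq` (…StabilityReductionA §K3): on `b·D₃` with vanishing virial, the site form of a cocycle that is linear `M` on the lattice is
  `¼·Qsum M b`;  `Fcc.S_a0_eq_zero` (the virial vanishes at `a₀`);
* `Fcc.stabIneq_record` (…StabilityNumerics, STAB-61 in the kernel): `(1/100)·Σ_{x ∈ nbhd a₀} ‖E(a₀x)‖² ≤ ¼·Qsum M a₀`, `E = (M + Mᵀ)/2`;
* the second moment of the `54` neighbours `{x ∈ D₃ : |x|² ≤ 8} ⊆ nbhd a₀`: `Σ x xᵀ = 96·I` (kernel evaluation via `Fcc.boxQ`), whence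
  `Σ_{x ∈ nbhd a₀} ‖E(a₀x)‖² ≥ 96·a₀²·‖E‖_F²`, and `a₀² > 2/5` (`Fcc.a0_sq_window`);
* `⟪u, A u⟫² = ⟪u, E u⟫² ≤ ‖E‖_F²` for unit `u` (Cauchy–Schwarz on the `9` entries).

Hence `q^∅_0(affineField A) ≥ (96/100)·a₀²·‖E‖_F² ≥ (3/8)·⟪u, A u⟫²`.  0 sorry; standard axioms.

## Contents
* §S1 coordinates: `Fcc.mat A` (the matrix of `A`), `Fcc.apply_eq_sum_mat`, `Fcc.affineField_zero_vec`, `Fcc.inner_apply_eq_sum`, `Fcc.sq_biform_le`.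
* §S2 the neighbour second moment: `Fcc.mom2`, `Fcc.boxQ_qMom` (kernel evaluation), `Fcc.mom2_eq`, `Fcc.neighbourSum_ge`.
* §S3 ★ `Fcc.sitewiseAffineStability_fccRef_a0` (`κ = 3/8`), `Fcc.sitewiseAffineStability_fccRef_a0_fifth` (`κ = 1/5`, motif form).
* §S4 isometry transport: `Fcc.conjA`, `Fcc.quadSite_affineField_transport`, `Fcc.sitewiseAffineStability_transport`,
  `Fcc.exists_linearIsometryEquiv_of_isometry`, `Fcc.sitewiseAffineStability_of_isometricImage_fccRef_a0` ([A-i], κ = 3/8, at every site of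
  every isometric image of the point set of `fccRef a₀`).
-/

noncomputable section

open scoped Classical
open Literature.MathematicalPhysics.StatisticalMechanics Literature.Geometry.DiscreteGeometry
open Summit.AtomisticToContinuum.Crystallization.Theses.PricedLinkCensus
open Summit.AtomisticToContinuum.Crystallization.Theorems.ChargedEnergyGapNegative

namespace Summit.AtomisticToContinuum.Crystallization.Theorems.ChargedEnergyGapChartDial

namespace Fcc

/-! ## §S1 Coordinates of a linear map; the bilinear Cauchy–Schwarz inequality -/

section Coordinates

/-- The matrix of a linear map of `E3` in the standard orthonormal basis: `mat A i j = (A e_j)_i`. -/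
def mat (A : E3 →ₗ[ℝ] E3) (i j : Fin 3) : ℝ :=
  A (EuclideanSpace.single j (1 : ℝ)) i

/-- A coordinate is the inner product with the standard basis vector. [formal bookkeeping] -/
theorem coord_eq_inner_single (w : E3) (i : Fin 3) : w i = inner ℝ (EuclideanSpace.single i (1 : ℝ)) w := by
  rw [EuclideanSpace.inner_single_left]
  simp

/-- `(A v)_i = Σ_j (mat A)_{ij} v_j`. [formal bookkeeping] -/
theorem apply_eq_sum_mat (A : E3 →ₗ[ℝ] E3) (v : E3) (i : Fin 3) : A v i = ∑ j, mat A i j * v j := by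
  set b := EuclideanSpace.basisFun (Fin 3) ℝ with hb
  have hv : A v = ∑ j, v j • A (EuclideanSpace.single j (1 : ℝ)) := by
    conv_lhs => rw [← b.sum_repr' v]
    rw [map_sum]
    refine Finset.sum_congr rfl fun j _ => ?_
    rw [map_smul, hb, EuclideanSpace.basisFun_apply, ← coord_eq_inner_single]
  rw [coord_eq_inner_single, hv, inner_sum]
  refine Finset.sum_congr rfl fun j _ => ?_
  rw [real_inner_smul_right, ← coord_eq_inner_single, mat, mul_comm]

/-- The affine field at the origin of `b·D₃` is linear on the lattice with matrix `mat A`. [formal bookkeeping] -/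
theorem affineField_zero_vec (A : E3 →ₗ[ℝ] E3) (b : ℝ) (x : Fin 3 → ℤ) (i : Fin 3) :
    affineField A 0 (vec b x) i = ∑ j, mat A i j * (((x j : ℝ)) * b) := by
  rw [affineField_apply, sub_zero, apply_eq_sum_mat]
  rfl

/-- `⟪u, A u⟫ = Σ_i Σ_j u_i (mat A)_{ij} u_j`. [formal bookkeeping] -/
theorem inner_apply_eq_sum (A : E3 →ₗ[ℝ] E3) (u : E3) : inner ℝ u (A u) = ∑ i, ∑ j, u i * mat A i j * u j := by
  have h1 : inner ℝ u (A u) = ∑ i, u i * A u i := by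
    simp only [PiLp.inner_apply, RCLike.inner_apply, conj_trivial]
    exact Finset.sum_congr rfl fun i _ => mul_comm _ _
  rw [h1]
  refine Finset.sum_congr rfl fun i _ => ?_
  rw [apply_eq_sum_mat, Finset.mul_sum]
  exact Finset.sum_congr rfl fun j _ => by ring

/-- Symmetrisation of the quadratic form: `Σ u_i M_ij u_j = Σ u_i ((M_ij + M_ji)/2) u_j`. [formal bookkeeping] -/
theorem sum_biform_symm (M : Fin 3 → Fin 3 → ℝ) (u : E3) :
    ∑ i, ∑ j, u i * M i j * u j = ∑ i, ∑ j, u i * ((M i j + M j i) / 2) * u j := by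
  have hT : ∑ i, ∑ j, u i * M i j * u j = ∑ i, ∑ j, u i * M j i * u j := by
    rw [Finset.sum_comm]
    exact Finset.sum_congr rfl fun i _ => Finset.sum_congr rfl fun j _ => by ring
  have : ∑ i, ∑ j, u i * ((M i j + M j i) / 2) * u j = (∑ i, ∑ j, u i * M i j * u j + ∑ i, ∑ j, u i * M j i * u j) / 2 := by
    rw [← Finset.sum_add_distrib, Finset.sum_div]
    refine Finset.sum_congr rfl fun i _ => ?_
    rw [← Finset.sum_add_distrib, Finset.sum_div]
    exact Finset.sum_congr rfl fun j _ => by ring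
  rw [this, ← hT]
  ring

/-- The unit sphere in coordinates: `‖u‖ = 1 ⟹ Σ u_i² = 1`. [formal bookkeeping] -/
theorem sum_sq_eq_one_of_norm {u : E3} (hu : ‖u‖ = 1) : ∑ i, u i ^ 2 = 1 := by
  have h := EuclideanSpace.real_norm_sq_eq u
  rw [hu, one_pow] at h
  exact h.symm

/-- CAUCHY–SCHWARZ for a bilinear form on the unit sphere: `(Σ_ij u_i E_ij u_j)² ≤ Σ_ij E_ij²` when `Σ u_i² = 1`. -/
theorem sq_biform_le (E : Fin 3 → Fin 3 → ℝ) {u : E3} (hu : ‖u‖ = 1) :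
    (∑ i, ∑ j, u i * E i j * u j) ^ 2 ≤ ∑ i, ∑ j, E i j ^ 2 := by
  have h1 : ∑ i, ∑ j, u i * E i j * u j = ∑ p : Fin 3 × Fin 3, E p.1 p.2 * (u p.1 * u p.2) := by
    rw [Fintype.sum_prod_type]
    exact Finset.sum_congr rfl fun i _ => Finset.sum_congr rfl fun j _ => by ring
  have h2 : ∑ i, ∑ j, E i j ^ 2 = ∑ p : Fin 3 × Fin 3, E p.1 p.2 ^ 2 := by
    rw [Fintype.sum_prod_type]
  have h3 : ∑ p : Fin 3 × Fin 3, (u p.1 * u p.2) ^ 2 = 1 := by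
    have : ∑ p : Fin 3 × Fin 3, (u p.1 * u p.2) ^ 2 = ∑ i, ∑ j, u i ^ 2 * u j ^ 2 := by
      rw [Fintype.sum_prod_type]
      exact Finset.sum_congr rfl fun i _ => Finset.sum_congr rfl fun j _ => by ring
    rw [this]
    simp_rw [← Finset.mul_sum, sum_sq_eq_one_of_norm hu, mul_one]
    exact sum_sq_eq_one_of_norm hu
  rw [h1, h2]
  calc (∑ p : Fin 3 × Fin 3, E p.1 p.2 * (u p.1 * u p.2)) ^ 2
      ≤ (∑ p : Fin 3 × Fin 3, E p.1 p.2 ^ 2) * ∑ p : Fin 3 × Fin 3, (u p.1 * u p.2) ^ 2 :=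
        Finset.sum_mul_sq_le_sq_mul_sq _ _ _
    _ = ∑ p : Fin 3 × Fin 3, E p.1 p.2 ^ 2 := by rw [h3, mul_one]

end Coordinates

/-! ## §S2 The second moment of the `54` neighbours `{x ∈ D₃ : |x|² ≤ 8}` and the neighbour-sum lower bound -/

section Moment

/-- The truncated second moment `Σ_{n ∈ D₃ ∩ [−2,2]³, |n|² ≤ 8} n_j n_k`. -/
def mom2 (j k : Fin 3) : ℝ :=
  ∑ n ∈ cubeD 2, (if nsq n.1 ≤ 8 then ((n.1 j : ℝ)) * ((n.1 k : ℝ)) else 0)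

/-- The rational table behind `mom2`. [formal bookkeeping] -/
def qMom (j k : Fin 3) (a b c : ℤ) : ℚ :=
  if nsqZ a b c ≤ 8 then (((mk3 a b c j * mk3 a b c k : ℤ)) : ℚ) else 0

/-- `mom2` is the computable box sum of `qMom`. [formal bookkeeping] -/
theorem mom2_eq_boxQ (j k : Fin 3) : mom2 j k = ((boxQ (qMom j k) 2 : ℚ) : ℝ) := by
  unfold mom2
  refine sum_cubeD_eq_boxQ 2 (fun x => if nsq x ≤ 8 then ((x j : ℝ)) * ((x k : ℝ)) else 0) (qMom j k) fun a b c => ?_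
  have hn : nsq (mk3 a b c) ≤ 8 ↔ nsqZ a b c ≤ 8 := by
    rw [nsq_mk3]
    exact_mod_cast Iff.rfl
  unfold qMom
  by_cases h : nsqZ a b c ≤ 8
  · rw [if_pos (hn.2 h), if_pos h]
    push_cast
    rfl
  · rw [if_neg (fun h' => h (hn.1 h')), if_neg h]
    push_cast
    rfl

/-- ★ KERNEL EVALUATION of the rational table: the `54` neighbours have isotropic second moment `96·I`. -/
theorem boxQ_qMom : ∀ j k : Fin 3, boxQ (qMom j k) 2 = if j = k then 96 else 0 := by
  decide +kernel

/-- The second moment of the `54` neighbours is `96·I`. -/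
theorem mom2_eq (j k : Fin 3) : mom2 j k = if j = k then 96 else 0 := by
  rw [mom2_eq_boxQ, boxQ_qMom]
  split_ifs <;> simp

/-- The neighbours with `|x|² ≤ 8` lie in `nbhd a₀` (`8·a₀² ≤ 8·(473/1000) < 4`). [formal bookkeeping] -/
theorem mem_nbhd_a0_of {n : D3} (hn : n ∈ cubeD 2) (h8 : nsq n.1 ≤ 8) : n.1 ∈ nbhd a0 := by
  rw [mem_nbhd_iff]
  have hc := (mem_cube_iff' 2 n.1).1 (mem_cubeD.1 hn)
  refine ⟨fun t => ⟨by have := (hc t).1; omega, by have := (hc t).2; omega⟩, n.2.1, n.2.2, ?_⟩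
  have ha := a0_sq_window.2
  nlinarith [nsq_nonneg n.1]

/-- Expansion of the neighbour term: `Σ_i (Σ_j E_ij x_j b)² = Σ_i Σ_j Σ_k E_ij E_ik b² · x_j x_k`. [formal bookkeeping] -/
theorem neighbourTerm_expand (E : Fin 3 → Fin 3 → ℝ) (b : ℝ) (x : Fin 3 → ℤ) :
    ∑ i, (∑ j, E i j * (((x j : ℝ)) * b)) ^ 2 = ∑ i, ∑ j, ∑ k, E i j * E i k * b ^ 2 * (((x j : ℝ)) * ((x k : ℝ))) := by
  refine Finset.sum_congr rfl fun i _ => ?_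
  rw [sq, Finset.sum_mul_sum]
  exact Finset.sum_congr rfl fun j _ => Finset.sum_congr rfl fun k _ => by ring

/-- ★ THE NEIGHBOUR-SUM LOWER BOUND: `96·a₀²·‖E‖_F² ≤ Σ_{x ∈ nbhd a₀} ‖E(a₀ x)‖²` (equality on the `54`-set; the rest is non-negative). -/
theorem neighbourSum_ge (E : Fin 3 → Fin 3 → ℝ) :
    96 * a0 ^ 2 * ∑ i, ∑ j, E i j ^ 2 ≤ ∑ x ∈ nbhd a0, ∑ i, (∑ j, E i j * (((x j : ℝ)) * a0)) ^ 2 := by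
  -- the truncated sum, written over `cubeD 2` with the indicator of `|n|² ≤ 8`
  set g : (Fin 3 → ℤ) → ℝ := fun x => ∑ i, (∑ j, E i j * (((x j : ℝ)) * a0)) ^ 2 with hg
  have hg0 : ∀ x, 0 ≤ g x := fun x => Finset.sum_nonneg fun i _ => sq_nonneg _
  -- (1) evaluation of the truncated sum
  have hval : ∑ n ∈ cubeD 2, (if nsq n.1 ≤ 8 then g n.1 else 0) = 96 * a0 ^ 2 * ∑ i, ∑ j, E i j ^ 2 := by
    have hpt : ∀ n : D3, (if nsq n.1 ≤ 8 then g n.1 else 0) =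
        ∑ i, ∑ j, ∑ k, E i j * E i k * a0 ^ 2 * (if nsq n.1 ≤ 8 then ((n.1 j : ℝ)) * ((n.1 k : ℝ)) else 0) := by
      intro n
      by_cases h : nsq n.1 ≤ 8
      · simp only [if_pos h, hg, neighbourTerm_expand]
      · simp only [if_neg h, mul_zero, Finset.sum_const_zero]
    rw [Finset.sum_congr rfl fun n _ => hpt n, Finset.sum_comm]
    have inner : ∀ i : Fin 3, ∑ n ∈ cubeD 2, ∑ j, ∑ k, E i j * E i k * a0 ^ 2 *
        (if nsq n.1 ≤ 8 then ((n.1 j : ℝ)) * ((n.1 k : ℝ)) else 0) = 96 * a0 ^ 2 * ∑ j, E i j ^ 2 := by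
      intro i
      rw [Finset.sum_comm]
      have hj : ∀ j : Fin 3, ∑ n ∈ cubeD 2, ∑ k, E i j * E i k * a0 ^ 2 *
          (if nsq n.1 ≤ 8 then ((n.1 j : ℝ)) * ((n.1 k : ℝ)) else 0) = 96 * a0 ^ 2 * E i j ^ 2 := by
        intro j
        rw [Finset.sum_comm]
        have hk : ∀ k : Fin 3, ∑ n ∈ cubeD 2, E i j * E i k * a0 ^ 2 *
            (if nsq n.1 ≤ 8 then ((n.1 j : ℝ)) * ((n.1 k : ℝ)) else 0) = E i j * E i k * a0 ^ 2 * mom2 j k := by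
          intro k
          rw [mom2, Finset.mul_sum]
        rw [Finset.sum_congr rfl fun k _ => hk k]
        simp_rw [mom2_eq, mul_ite, mul_zero, Finset.sum_ite_eq, Finset.mem_univ, if_true]
        ring
      rw [Finset.sum_congr rfl fun j _ => hj j, Finset.mul_sum]
    rw [Finset.sum_congr rfl fun i _ => inner i, Finset.mul_sum]
  -- (2) the truncated sum is below the neighbour sum
  have hle : ∑ n ∈ cubeD 2, (if nsq n.1 ≤ 8 then g n.1 else 0) ≤ ∑ x ∈ nbhd a0, g x := by
    rw [← Finset.sum_filter]
    have hmap : ∑ n ∈ (cubeD 2).filter (fun n => nsq n.1 ≤ 8), g n.1 =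
        ∑ x ∈ ((cubeD 2).filter (fun n => nsq n.1 ≤ 8)).map (Function.Embedding.subtype _), g x := by
      simp only [Finset.sum_map, Function.Embedding.coe_subtype]
    rw [hmap]
    refine Finset.sum_le_sum_of_subset_of_nonneg (fun x hx => ?_) fun x _ _ => hg0 x
    rw [Finset.mem_map] at hx
    obtain ⟨n, hn, rfl⟩ := hx
    rw [Finset.mem_filter] at hn
    exact mem_nbhd_a0_of hn.1 hn.2
  rw [← hval]
  exact hle

end Moment

/-! ## §S3 ★ [A-i] at the stress-free fcc reference -/

section Stability

/-- The unexcised quadratic site form of the affine field at the origin of `fccRef a₀` is `¼·Qsum (mat A) a₀`. -/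
theorem quadSite_affineField_fccRef_a0 (A : E3 →ₗ[ℝ] E3) :
    quadSite (affineField A) (fccRef a0 a0_pos) ∅ 0 = (1 / 4) * Qsum (mat A) a0 :=
  quadSite_eq a0_pos (fun x _ i => affineField_zero_vec A a0 x i) S_a0_eq_zero

/-- ★★ **[A-i] AT THE fcc REFERENCE, `κ = 3/8`.**  For every linear `A` and unit `u`:
`(3/8)·⟪u, A u⟫² ≤ q^∅_0(affineField A)` on `fccRef a₀` — sitewise affine (elastic) stability of the Lennard-Jones fcc lattice with an
explicit margin, from STAB-61 (`stabIneq_record`), the `54`-neighbour second moment and `a₀² > 2/5`. -/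
theorem sitewiseAffineStability_fccRef_a0 (A : E3 →ₗ[ℝ] E3) (u : E3) (hu : ‖u‖ = 1) :
    (3 / 8) * inner ℝ u (A u) ^ 2 ≤ quadSite (affineField A) (fccRef a0 a0_pos) ∅ 0 := by
  set M := mat A with hM
  set E : Fin 3 → Fin 3 → ℝ := fun i j => (M i j + M j i) / 2 with hE
  -- ⟪u, A u⟫² ≤ ‖E‖_F²
  have h1 : inner ℝ u (A u) ^ 2 ≤ ∑ i, ∑ j, E i j ^ 2 := by
    rw [inner_apply_eq_sum, ← hM, sum_biform_symm M u]
    exact sq_biform_le E hu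
  -- STAB-61: (1/100)·Σ_nbhd ‖E(a₀x)‖² ≤ ¼ Qsum
  have h2 : (1 / 100) * ∑ x ∈ nbhd a0, ∑ i, (∑ j, E i j * (((x j : ℝ)) * a0)) ^ 2 ≤ (1 / 4) * Qsum M a0 :=
    stabIneq_record M
  -- the neighbour sum dominates 96 a₀² ‖E‖²
  have h3 := neighbourSum_ge E
  have ha := a0_sq_window.1
  have hF : 0 ≤ ∑ i, ∑ j, E i j ^ 2 := Finset.sum_nonneg fun i _ => Finset.sum_nonneg fun j _ => sq_nonneg _
  rw [quadSite_affineField_fccRef_a0, ← hM]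
  nlinarith

/-- ★ [A-i] at the fcc reference in the MOTIF form consumed by `SitewiseAffineStabilityB`/`SitewiseAffineStabilityLoc`, at the record value
`κ = 1/5` (the motif of `fccRef a₀` is `{0}`). -/
theorem sitewiseAffineStability_fccRef_a0_fifth :
    ∀ y ∈ (fccRef a0 a0_pos).motif, ∀ (A : E3 →ₗ[ℝ] E3) (u : E3), ‖u‖ = 1 →
      (1 / 5) * inner ℝ u (A u) ^ 2 ≤ quadSite (affineField A) (fccRef a0 a0_pos) ∅ y := by
  intro y hy A u hu
  rw [fccRef_motif, Finset.mem_singleton] at hy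
  subst hy
  have h := sitewiseAffineStability_fccRef_a0 A u hu
  nlinarith [sq_nonneg (inner ℝ u (A u))]

end Stability

/-! ## §S4 ISOMETRY TRANSPORT of the affine probe (towards the CLASS-level [A-i]ᶠ)

`quadSite β P X y` depends on `P` only through `P.points`; along a rigid motion `x ↦ L x + c` (`L` a linear isometry) the affine probe
field `z ↦ A (z − y)` pulls back to the CONJUGATED probe `L⁻¹ A L`, and `⟪u, A u⟫` to `⟪L⁻¹u, (L⁻¹AL)(L⁻¹u)⟫`.  Hence the sitewise affine
stability inequality (all `A`, all unit `u`) is transported verbatim from a reference configuration to every rigid image of it, at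
every image site.  Combined with the lattice translations of `fccRef a₀` this gives [A-i] at EVERY site of every rigid image of the
stress-free fcc reference (`sitewiseAffineStability_of_rigidImage_fccRef_a0`).  What then remains for the fcc CLASS is only (U-f): a
site-stress-free fcc-class Barlow image in the window IS such a rigid image (uniqueness of the stress-free scale/ratio). -/

/-- The probe conjugated by a linear isometry: `(L⁻¹ A L)`. -/
def conjA (L : E3 ≃ₗᵢ[ℝ] E3) (A : E3 →ₗ[ℝ] E3) : E3 →ₗ[ℝ] E3 :=
  (L.symm.toLinearEquiv : E3 →ₗ[ℝ] E3) ∘ₗ A ∘ₗ (L.toLinearEquiv : E3 →ₗ[ℝ] E3)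

/-- Pointwise form of the conjugated probe. -/
theorem conjA_apply (L : E3 ≃ₗᵢ[ℝ] E3) (A : E3 →ₗ[ℝ] E3) (v : E3) : conjA L A v = L.symm (A (L v)) := rfl

/-- Bondwise transport: the quadratic bond term of the probe `A` on the moved bond equals that of the conjugated probe on the original bond. -/
theorem bondQuad_affineField_conj (L : E3 ≃ₗᵢ[ℝ] E3) (c : E3) (A : E3 →ₗ[ℝ] E3) (y z : E3) :
    bondQuad (affineField A) (L y + c) (L z + c) = bondQuad (affineField (conjA L A)) y z := by
  have hd : dist (L y + c) (L z + c) = dist y z := by rw [dist_add_right, L.dist_map]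
  have hsub : (L z + c) - (L y + c) = L (z - y) := by rw [add_sub_add_right_eq_sub, map_sub]
  have hAL : A (L (z - y)) = L (conjA L A (z - y)) := by rw [conjA_apply, L.apply_symm_apply]
  have hin : inner ℝ ((dist y z)⁻¹ • L (z - y)) (A (L (z - y))) = inner ℝ ((dist y z)⁻¹ • (z - y)) (conjA L A (z - y)) := by
    rw [hAL, ← map_smul, L.inner_map_map]
  have hn : ‖A (L (z - y))‖ = ‖conjA L A (z - y)‖ := by rw [hAL, L.norm_map]
  simp only [bondQuad, affineField_apply, hd, hsub, hin, hn]

/-- Sitewise transport of the quadratic site term of an affine probe along the rigid motion `x ↦ L x + c`. -/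
theorem quadSite_affineField_transport (L : E3 ≃ₗᵢ[ℝ] E3) (c : E3) (A : E3 →ₗ[ℝ] E3)
    {P P' : PeriodicConfiguration 3} {X X' : Set E3}
    (hP : P'.points = (fun x => L x + c) '' P.points) (hX : X' = (fun x => L x + c) '' X) (y : E3) :
    quadSite (affineField A) P' X' (L y + c) = quadSite (affineField (conjA L A)) P X y := by
  unfold quadSite
  congr 1
  set g : E3 → E3 := fun x => L x + c with hg
  have hinj : Function.Injective g := fun a b h => L.injective (add_right_cancel h)
  let gE : E3 ≃ E3 := L.toLinearEquiv.toEquiv.trans (Equiv.addRight c)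
  have hgE : ∀ x, gE x = g x := fun x => rfl
  have hiff : ∀ z : E3, (z ∈ P.points ∧ z ∉ X ∧ z ≠ y) ↔ (gE z ∈ P'.points ∧ gE z ∉ X' ∧ gE z ≠ L y + c) := by
    intro z
    rw [hgE, hP, hX, hinj.mem_set_image, hinj.mem_set_image, show L y + c = g y from rfl, hinj.ne_iff]
  let e := Equiv.subtypeEquiv (p := fun z => z ∈ P.points ∧ z ∉ X ∧ z ≠ y)
    (q := fun z => z ∈ P'.points ∧ z ∉ X' ∧ z ≠ L y + c) gE hiff
  rw [← Equiv.tsum_eq e]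
  refine tsum_congr fun z => ?_
  have hz : ((e z : {z : E3 // z ∈ P'.points ∧ z ∉ X' ∧ z ≠ L y + c}) : E3) = L z + c := rfl
  rw [hz]
  exact bondQuad_affineField_conj L c A y z

/-- ★ TRANSPORT OF SITEWISE AFFINE STABILITY along a rigid motion (all probes `A`, all unit directions `u`; the constant `κ` is unchanged). -/
theorem sitewiseAffineStability_transport (L : E3 ≃ₗᵢ[ℝ] E3) (c : E3) {P P' : PeriodicConfiguration 3} {X X' : Set E3}
    (hP : P'.points = (fun x => L x + c) '' P.points) (hX : X' = (fun x => L x + c) '' X) (y : E3) (κ : ℝ)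
    (h : ∀ (A : E3 →ₗ[ℝ] E3) (u : E3), ‖u‖ = 1 → κ * inner ℝ u (A u) ^ 2 ≤ quadSite (affineField A) P X y) :
    ∀ (A : E3 →ₗ[ℝ] E3) (u : E3), ‖u‖ = 1 → κ * inner ℝ u (A u) ^ 2 ≤ quadSite (affineField A) P' X' (L y + c) := by
  intro A u hu
  rw [quadSite_affineField_transport L c A hP hX y]
  have hu' : ‖L.symm u‖ = 1 := by rw [L.symm.norm_map]; exact hu
  have key := h (conjA L A) (L.symm u) hu'
  have hin : inner ℝ (L.symm u) (conjA L A (L.symm u)) = inner ℝ u (A u) := by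
    rw [conjA_apply, L.apply_symm_apply, L.symm.inner_map_map]
  rwa [hin] at key

/-- The point set of `fccRef b` is a lattice: translating by one of its points leaves it invariant. -/
theorem fccRef_points_translate {b : ℝ} (hb : 0 < b) {x : E3} (hx : x ∈ (fccRef b hb).points) :
    (fccRef b hb).points = (fun z => LinearIsometryEquiv.refl ℝ E3 z + x) '' (fccRef b hb).points := by
  ext z
  simp only [LinearIsometryEquiv.coe_refl, id_eq, Set.mem_image]
  rw [mem_points_iff_lattice] at hx ⊢
  constructor
  · intro hz
    refine ⟨z - x, ?_, sub_add_cancel z x⟩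
    rw [mem_points_iff_lattice]; exact Submodule.sub_mem _ hz hx
  · rintro ⟨w, hw, rfl⟩
    rw [mem_points_iff_lattice] at hw; exact Submodule.add_mem _ hw hx

/-- [A-i] at EVERY site of the stress-free fcc reference (lattice translation of `sitewiseAffineStability_fccRef_a0`). -/
theorem sitewiseAffineStability_fccRef_a0_points : ∀ y ∈ (fccRef a0 a0_pos).points, ∀ (A : E3 →ₗ[ℝ] E3) (u : E3), ‖u‖ = 1 →
    (3 / 8) * inner ℝ u (A u) ^ 2 ≤ quadSite (affineField A) (fccRef a0 a0_pos) ∅ y := by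
  intro y hy A u hu
  have h := sitewiseAffineStability_transport (LinearIsometryEquiv.refl ℝ E3) y (P := fccRef a0 a0_pos) (P' := fccRef a0 a0_pos)
    (X := ∅) (X' := ∅) (fccRef_points_translate a0_pos hy) (by simp) 0 (3 / 8) (sitewiseAffineStability_fccRef_a0) A u hu
  simpa using h

/-- ★★ [A-i] ON EVERY RIGID IMAGE of the stress-free fcc reference, at every site, κ = 3/8: the CLASS-level input modulo (U-f). -/
theorem sitewiseAffineStability_of_rigidImage_fccRef_a0 (P : PeriodicConfiguration 3) (L : E3 ≃ₗᵢ[ℝ] E3) (c : E3)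
    (hP : P.points = (fun x => L x + c) '' (fccRef a0 a0_pos).points) :
    ∀ y ∈ P.points, ∀ (A : E3 →ₗ[ℝ] E3) (u : E3), ‖u‖ = 1 → (3 / 8) * inner ℝ u (A u) ^ 2 ≤ quadSite (affineField A) P ∅ y := by
  intro y hy A u hu
  rw [hP] at hy
  obtain ⟨x, hx, rfl⟩ := hy
  exact sitewiseAffineStability_transport L c (P := fccRef a0 a0_pos) (P' := P) (X := ∅) (X' := ∅) hP (by simp) x (3 / 8)
    (sitewiseAffineStability_fccRef_a0_points x hx) A u hu

/-- A Euclidean isometry of `E3` is a rigid motion `x ↦ L x + c` with `L` a linear isometry (strict convexity + finite dimension). -/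
theorem exists_linearIsometryEquiv_of_isometry {g : E3 → E3} (hg : Isometry g) :
    ∃ (L : E3 ≃ₗᵢ[ℝ] E3) (c : E3), ∀ x, g x = L x + c := by
  let F : E3 →ᵃⁱ[ℝ] E3 := hg.affineIsometryOfStrictConvexSpace
  have hF : ∀ x, F x = g x := fun x => rfl
  let L : E3 ≃ₗᵢ[ℝ] E3 := F.linearIsometry.toLinearIsometryEquiv rfl
  have hL : ∀ v, L v = F.linearIsometry v := fun v => F.linearIsometry.toLinearIsometryEquiv_apply rfl v
  refine ⟨L, g 0, fun x => ?_⟩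
  have h1 : F x = F.linearIsometry (x -ᵥ (0 : E3)) +ᵥ F 0 := by rw [← F.map_vadd, vsub_vadd]
  rw [← hF x, h1, ← hF 0, vsub_eq_sub, sub_zero, vadd_eq_add, hL]

/-- Hence: [A-i] (κ = 3/8) at every site of every ISOMETRIC image of the stress-free fcc reference point set. -/
theorem sitewiseAffineStability_of_isometricImage_fccRef_a0 (P : PeriodicConfiguration 3) {g : E3 → E3} (hg : Isometry g)
    (hP : P.points = g '' (fccRef a0 a0_pos).points) :
    ∀ y ∈ P.points, ∀ (A : E3 →ₗ[ℝ] E3) (u : E3), ‖u‖ = 1 → (3 / 8) * inner ℝ u (A u) ^ 2 ≤ quadSite (affineField A) P ∅ y := by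
  obtain ⟨L, c, hLc⟩ := exists_linearIsometryEquiv_of_isometry hg
  have hP' : P.points = (fun x => L x + c) '' (fccRef a0 a0_pos).points := by
    rw [hP]; exact Set.image_congr fun x _ => hLc x
  exact sitewiseAffineStability_of_rigidImage_fccRef_a0 P L c hP'

end Fcc

end Summit.AtomisticToContinuum.Crystallization.Theorems.ChargedEnergyGapChartDial
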